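import Summits.PneNP.PneNP.Theorems.CliqueExtLowerBound.Negative.LoadBearing
import Summits.PneNP.PneNP.Theorems.LinAlgGateBlind.Negative.ValiantCertificate

/-!
# `CliqueExtLowerBound` (stmt-PneNP-10682, route PneNP/ConvexRankGates) — negative-side lemmas: GRANK consequences

The third wide gate class alone. The sibling seat for crux #4 (`LinAlgGateBlind`, cdisprove-10681) landed
`Theorems/LinAlgGateBlind/Negative/ValiantCertificate.lean`: ONE GRANK gate over `ℚ` of dimension
`1 + C(m,k)·#E(K_m)` computes `CLIQUE(m,k)` for `k ≥ 2` (size-tracked Valiant path blocks of the clique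
polynomial). Drawn from it here, for THIS crux (the full basis), by the standing adversary (cdisprove,
gen 3) — completing the trichotomy begun in `LoadBearing.lean` (CONV: one LP gate) and
`PermSpanProgram.lean` / `PermConsequences.lean` (PERM: one cycle span program):

* `GRankLowerBoundAt`, `gRankLowerBoundAt_of_lowerBoundAt` — schedule form of the lower bound over the
  GRANK-only sub-basis `{∧₂, ∨₂} ∪ GRANK_{m^c}`; the full-basis bound implies it.
* `grankWidth_le_of_choose_le` — `1 + C(m,k)·#E ≤ m^{j+3}` once `C(m,k) ≤ m^j` (`m ≥ 2`).
* `not_gRankLowerBoundAt_of_choose_le` (+ `_const`, `_sub_const`) — ONE GRANK gate kills every schedule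
  with `C(m, k m) ≤ m^j` and `k m ≥ 2` eventually: the schedule refutations of `LoadBearing.lean` §1 hold
  over EACH of the three one-class sub-bases separately (CONV: `not_lowerBoundAt_of_choose_le`; PERM:
  `not_linLowerBoundAt_of_choose_le`; GRANK: this file).
* `cliqueExtLowerBound_false_without_grankDim` — the GRANK dimension bound `d ≤ s` of the crux is
  load-bearing on its own: dropping it (GRANK gates of ANY dimension, everything else as filed) falsifies
  the statement already at `c = 0`. With `LoadBearing.cliqueExtLowerBound_false_without_width` (CONV) and
  `PermConsequences.cliqueExtLowerBound_false_without_permDim` (PERM): EACH of the three width parameters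
  inside `Ext` is used by any proof.
* `grank_dim_lower_bound_of_cliqueExtLowerBound` — SANITY IMPLICATION in gate language: the crux implies
  that for every `c`, eventually NO single GRANK gate of dimension `≤ m^c` (any field, any wiring of its
  inputs to edges, repeated wires allowed) computes `CLIQUE(m, ⌈m^δ⌉₊)` — the "GRANK door blind" statement,
  which by `ValiantCertificate.dc_cliquePoly_superpolynomial_of_linAlgGateBlind` (sibling) is at least a
  superpolynomial determinantal-complexity bound for the clique polynomials over every field.

Refuter seat cdisprove-stmt-PneNP-10682-g3, 2026-08-16.
-/

namespace Summit.PneNP.PneNP.Theorems.CliqueExtLowerBound.Negative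

open Literature.Computability.Complexity Literature.Computability.Complexity.CliqueLPGate Filter Finset
open Summit.PneNP.PneNP.Theses.ConvexRankGates (CliqueExtLowerBound)
open Summit.PneNP.PneNP.Theorems.LinAlgGateBlind.Negative (exists_oneGRankGate_computes_cliqueFn)

/-! ### 1. The GRANK-only sub-basis and its schedule refutations -/

/-- Lower bound at schedule `k` over the GRANK-only sub-basis `{∧₂, ∨₂} ∪ GRANK_{m^c}`. [folklore] -/
def GRankLowerBoundAt (k : ℕ → ℕ) : Prop :=
  ∀ c : ℕ, ∀ᶠ m : ℕ in atTop, ∀ C : Circuit ((⊤ : SimpleGraph (Fin m)).edgeSet),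
    C.IsOver ({GateFn.and 2, GateFn.or 2} ∪ {g | IsGRankGate (m ^ c) g}) →
      C.size ≤ m ^ c → ¬ C.Computes (cliqueFn m (k m))

/-- The full basis contains the GRANK-only sub-basis: `LowerBoundAt k → GRankLowerBoundAt k`. [folklore] -/
theorem gRankLowerBoundAt_of_lowerBoundAt {k : ℕ → ℕ} (h : LowerBoundAt k) : GRankLowerBoundAt k := by
  intro c
  filter_upwards [h c] with m hm C hC hs
  refine hm C (hC.mono ?_) hs
  rintro g (hg | hg)
  · exact monotoneBasis_subset_extGate _ hg
  · exact IsGRankGate.mem_extGate hg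

/-- Width bookkeeping: `1 + C(m,k)·#E(K_m) ≤ m^{j+3}` once `C(m,k) ≤ m^j` and `m ≥ 2`. [folklore] -/
theorem grankWidth_le_of_choose_le (m k j : ℕ) (hm : 2 ≤ m) (hq : m.choose k ≤ m ^ j) :
    1 + m.choose k * nE m ≤ m ^ (j + 3) := by
  have h1 : m.choose k * nE m ≤ m ^ (j + 2) :=
    calc m.choose k * nE m ≤ m ^ j * m ^ 2 := Nat.mul_le_mul hq (nE_le m)
      _ = m ^ (j + 2) := by rw [← pow_add]
  have h2 : 1 ≤ m ^ (j + 2) := Nat.one_le_pow _ _ (by omega)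
  calc 1 + m.choose k * nE m ≤ m ^ (j + 2) + m ^ (j + 2) := add_le_add h2 h1
    _ = 2 * m ^ (j + 2) := by ring
    _ ≤ m * m ^ (j + 2) := Nat.mul_le_mul_right _ hm
    _ = m ^ (j + 3) := by ring

/-- **One GRANK gate kills every polynomially-enumerable schedule over the GRANK-only sub-basis**: if
`C(m, k m) ≤ m^j` and `k m ≥ 2` eventually, then `GRankLowerBoundAt k` is false (at `c = j + 3` the
size-1 circuit of `exists_oneGRankGate_computes_cliqueFn` has dimension `≤ m^{j+3}`). [folklore] -/
theorem not_gRankLowerBoundAt_of_choose_le {k : ℕ → ℕ} {j : ℕ} (h2 : ∀ᶠ m : ℕ in atTop, 2 ≤ k m)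
    (h : ∀ᶠ m : ℕ in atTop, m.choose (k m) ≤ m ^ j) : ¬ GRankLowerBoundAt k := by
  intro hLB
  obtain ⟨m, hm, hk, hch, h2m⟩ := ((hLB (j + 3)).and (h2.and (h.and (eventually_ge_atTop 2)))).exists
  obtain ⟨C, hC, hs, hc⟩ := exists_oneGRankGate_computes_cliqueFn m (k m) hk
  refine hm C (hC.mono ?_) (hs.trans (Nat.one_le_pow _ _ (by omega))) hc
  intro g hg
  exact Or.inr (IsGRankGate.mono hg (grankWidth_le_of_choose_le m (k m) j h2m hch))

/-- Constant `k ≥ 2` over the GRANK-only sub-basis: false. [folklore] -/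
theorem not_gRankLowerBoundAt_const {k : ℕ} (hk : 2 ≤ k) : ¬ GRankLowerBoundAt fun _ => k :=
  not_gRankLowerBoundAt_of_choose_le (j := k) (Eventually.of_forall fun _ => hk)
    (Eventually.of_forall fun m => Nat.choose_le_pow m k)

/-- `k = m - t` over the GRANK-only sub-basis: false. [folklore] -/
theorem not_gRankLowerBoundAt_sub_const (t : ℕ) : ¬ GRankLowerBoundAt fun m => m - t := by
  refine not_gRankLowerBoundAt_of_choose_le (j := t) ?_ ?_
  · filter_upwards [eventually_ge_atTop (t + 2)] with m hm
    omega
  · filter_upwards [eventually_ge_atTop t] with m hm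
    rw [Nat.choose_symm hm]
    exact Nat.choose_le_pow m t

/-! ### 2. The GRANK dimension bound is load-bearing for the crux -/

/-- **Any proof must use the GRANK dimension bound**: the crux with `d ≤ s` dropped in the GRANK
disjunct (GRANK gates of ANY dimension; everything else as filed) is false already at `c = 0` — ONE GRANK
gate over `ℚ` (the Valiant path-block matrix of the clique polynomial) computes `CLIQUE(m, ⌈m^δ⌉₊)`.
[folklore] -/
theorem cliqueExtLowerBound_false_without_grankDim :
    ¬ ∃ δ : ℝ, 0 < δ ∧ δ < 1 / 2 ∧ ∀ c : ℕ, ∀ᶠ m : ℕ in atTop,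
      ∀ C : Circuit ((⊤ : SimpleGraph (Fin m)).edgeSet),
        C.IsOver ({GateFn.and 2, GateFn.or 2} ∪
          {g | IsConvGate (m ^ c) g ∨ IsPermGate (m ^ c) g ∨ ∃ w, IsGRankGate w g}) →
        C.size ≤ m ^ c → ¬ C.Computes (cliqueFn m ⌈(m : ℝ) ^ δ⌉₊) := by
  rintro ⟨δ, hδ0, -, h⟩
  obtain ⟨m, hm, h2⟩ := ((h 0).and (eventually_ge_atTop 2)).exists
  obtain ⟨C, hC, hs, hc⟩ := exists_oneGRankGate_computes_cliqueFn m ⌈(m : ℝ) ^ δ⌉₊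
    (two_le_ceil_rpow hδ0 h2)
  refine hm C (hC.mono fun g hg => Or.inr (Or.inr (Or.inr ⟨_, hg⟩))) ?_ hc
  simpa using hs

/-! ### 3. Sanity implication: the crux in single-GRANK-gate language -/

/-- **The crux implies that the GRANK door alone is blind**: if `CliqueExtLowerBound` holds with exponent
`δ`, then for every `c`, eventually in `m`, NO single GRANK gate of dimension `≤ m^c` — any field, any
number `n` of inputs, input `i` reading the edge `w i` — computes `CLIQUE(m, ⌈m^δ⌉₊)` (it would be a
size-1 circuit over `B_{m^c}`). By the sibling file `ValiantCertificate.lean` this consequence is already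
Valiant-hard (a superpolynomial determinantal-complexity bound for an explicit family over every field);
it is recorded so that a refutation of THIS consequence would refute the crux. [folklore] -/
theorem grank_dim_lower_bound_of_cliqueExtLowerBound (h : CliqueExtLowerBound) :
    ∃ δ : ℝ, 0 < δ ∧ δ < 1 / 2 ∧ ∀ c : ℕ, ∀ᶠ m : ℕ in atTop,
      ∀ (n : ℕ) (f : (Fin n → Bool) → Bool) (w : Fin n → (⊤ : SimpleGraph (Fin m)).edgeSet),
        IsGRankGate (m ^ c) ⟨n, f⟩ →
        ¬ ∀ x : (⊤ : SimpleGraph (Fin m)).edgeSet → Bool,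
          f (fun i => x (w i)) = cliqueFn m ⌈(m : ℝ) ^ δ⌉₊ x := by
  classical
  obtain ⟨δ, hδ0, hδ1, hLB⟩ := cliqueExtLowerBound_iff.1 h
  refine ⟨δ, hδ0, hδ1, fun c => ?_⟩
  filter_upwards [hLB c, eventually_ge_atTop 1] with m hm h1 n f w hgate hcomp
  obtain ⟨C, hC, hs, he⟩ := (CktSize.gate (B := extGate (m ^ c)) ⟨n, f⟩ hgate.mem_extGate w).toCircuit
  refine hm C hC (hs.trans (Nat.one_le_pow _ _ h1)) fun x => ?_
  rw [he x]
  exact hcomp x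

end Summit.PneNP.PneNP.Theorems.CliqueExtLowerBound.Negative
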